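import Summits.HubbardSuperconductivity.HubbardSuperconductivity.Theorems.MesoscopicPairOrder.Negative.StonerExactDoublon
import HarnessLib

/-!
# Crux `MesoscopicPairOrder` (stmt-HubbardSuperconductivity-7331), Negative side:
# fourth band moment and the Stoner spin ceiling with an ABSTRACT hinge bound

Line `redirect_birth` (lead c11), Negative programme E1 (no nearly saturated ferromagnetism on the (Q)/(D) box).
`StonerShiftedBand.lean` (lead c10) bounds the polarised `↑` band through the degree-2 tangent-parabola majorant
of the hinge, `Σ_k (μ - ε_L(k))₊ ≤ L²(4 + t²)/(4(t - μ))`; at the relevant multipliers `μ ∈ [1, 2.9]` this loses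
`0.20–0.26 t` per site against the exact bathtub — the larger half of what separates the certified `U ≤ 7/2`
(`StonerExactDoublonBox.lean`) from the continuum Stoner threshold `U ≈ 6.3`. Here:

* `torusPhase_single_natCast`, `sum_cos_natMul_latticeMomentum_eq_zero` — the character at `j e_i` (`0 < j < L`):
  `Σ_k cos(j p_i(k)) = 0`;
* `sum_cos_pow_three_latticeMomentum` (`= 0`, `L ≥ 4`), `sum_cos_pow_four_latticeMomentum` (`= 3L²/8`, `L ≥ 5`),
  the one-coordinate sums `sum_cos_sq_val` (`= L/2`), `sum_cos_pow_three_val` (`= 0`), and the band moments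
  **`sum_torusBand_pow_three` (`Σ_k ε_L(k)³ = 0`)**, **`sum_torusBand_pow_four` (`Σ_k ε_L(k)⁴ = 36 L²`)**
  (`E[ε^{2j}] = C(2j,j)²`: `1, 4, 36, 400, …`);
* `sum_posPart_le_of_quartic` — any quartic majorant `P ≥ (μ - ·)₊` on `[-4, 4]` gives
  `Σ_k (μ - ε_L(k))₊ ≤ L²(p₀ + 4p₂ + 36p₄)`;
* `re_expect_hubbardTorus_zero_ge_hinge`, `hinge_spin_le_of_groundState`, `hinge_spin_le_of_pairedSea_exact` —
  the Stoner ceiling with an ABSTRACT hinge bound `Σ_k (μ - ε_L(k))₊ ≤ H`: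
  **`2μn - H - 2Σ_{k∈l} ε_L(k) - U n²/L² ≤ (μ + 4)(n - S)`** for every ground multiplet of spin `S` of the
  `(2n, S^z = 0)` sector and every `n`-momentum paired Fermi sea `l` (`shifted_spin_le_of_pairedSea_exact` is the
  case `H = L²(4+t²)/(4(t-μ))`).
The lattice-sum evaluation on the box (degree-4 majorants, diamond seas) is a companion file.
Sources: E. C. Stoner, Proc. R. Soc. A 165 (1938) 372; E. H. Lieb, M. Loss, *Analysis* (2001) Thm 1.14
(bathtub, Lagrangian form); H. Tasaki, Prog. Theor. Phys. 99 (1998) 489, §5. Folklore finite-dimensional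
statements; no definition, no named fact, no sorry.
-/

noncomputable section

-- the summit namespace repeats the problem name by design (D-0017)
set_option linter.dupNamespace false

namespace Summit.HubbardSuperconductivity.HubbardSuperconductivity.Theorems.MesoscopicPairOrder.Negative

open Matrix Finset Filter
open Literature.Probability.LatticeModels Literature.MathematicalPhysics.QuantumLattice
open scoped ComplexOrder ComplexConjugate

section Quartic

variable {L : ℕ} [NeZero L]

/-! ### Characters at `j e_i` and the vanishing cosine sums -/

omit [NeZero L] in
/-- The phase of the character at `j e_i` is `j` times the `i`-th lattice momentum (`j < L`, so that
`(j : ℤ/Lℤ).val = j`). [folklore] -/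
theorem torusPhase_single_natCast {j : ℕ} (hj : j < L) (q : TorusSite 2 L) (i : Fin 2) :
    torusPhase L q (Pi.single i ((j : ℕ) : ZMod L)) = j * latticeMomentum L q i := by
  unfold torusPhase
  rw [latticeMomentum_apply]
  have hval : ∀ j' : Fin 2, (((Pi.single i ((j : ℕ) : ZMod L) : TorusSite 2 L) j').val : ℝ) =
      if j' = i then (j : ℝ) else 0 := by
    intro j'
    by_cases hj' : j' = i
    · subst hj'
      rw [Pi.single_eq_same, if_pos rfl, ZMod.val_natCast, Nat.mod_eq_of_lt hj]
    · rw [Pi.single_eq_of_ne hj', ZMod.val_zero, if_neg hj']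
      norm_num
  simp_rw [hval, mul_ite, mul_zero]
  rw [Finset.sum_ite_eq' Finset.univ i, if_pos (Finset.mem_univ i)]
  ring

/-- **`Σ_k cos(j p_i(k)) = 0`** on the `L × L` torus for `0 < j < L` (the character at `j e_i ≠ 0`). [folklore] -/
theorem sum_cos_natMul_latticeMomentum_eq_zero {j : ℕ} (hj0 : 0 < j) (hjL : j < L) (i : Fin 2) :
    ∑ k : TorusSite 2 L, Real.cos (j * latticeMomentum L k i) = 0 := by
  have hw : (Pi.single i ((j : ℕ) : ZMod L) : TorusSite 2 L) ≠ 0 := fun h => by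
    have h2 := congrFun h i
    rw [Pi.single_eq_same, Pi.zero_apply] at h2
    have h3 := congrArg ZMod.val h2
    rw [ZMod.val_natCast, Nat.mod_eq_of_lt hjL, ZMod.val_zero] at h3
    omega
  have h := congrArg Complex.re (sum_torusChar L (Pi.single i ((j : ℕ) : ZMod L) : TorusSite 2 L))
  rw [if_neg hw, Complex.zero_re, Complex.re_sum] at h
  simp_rw [torusChar_re, torusPhase_single_natCast hjL] at h
  exact h

/-- **`Σ_k cos³(p_i(k)) = 0`** (`L ≥ 4`): `cos³ = (3 cos + cos(3·))/4`. [folklore] -/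
theorem sum_cos_pow_three_latticeMomentum (hL : 4 ≤ L) (i : Fin 2) :
    ∑ k : TorusSite 2 L, Real.cos (latticeMomentum L k i) ^ 3 = 0 := by
  have e : ∀ k : TorusSite 2 L, Real.cos (latticeMomentum L k i) ^ 3 =
      (3 * Real.cos (latticeMomentum L k i) + Real.cos (3 * latticeMomentum L k i)) / 4 := by
    intro k
    rw [Real.cos_three_mul]
    ring
  simp_rw [e]
  rw [← Finset.sum_div, Finset.sum_add_distrib, ← Finset.mul_sum]
  have h1 := sum_cos_natMul_latticeMomentum_eq_zero (L := L) (j := 1) (by norm_num) (by omega) i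
  have h3 := sum_cos_natMul_latticeMomentum_eq_zero (L := L) (j := 3) (by norm_num) (by omega) i
  simp only [Nat.cast_one, one_mul] at h1
  simp only [Nat.cast_ofNat] at h3
  rw [h1, h3]
  norm_num

/-- **`Σ_k cos⁴(p_i(k)) = 3L²/8`** (`L ≥ 5`): `cos⁴ = 3/8 + cos(2·)/2 + cos(4·)/8`. [folklore] -/
theorem sum_cos_pow_four_latticeMomentum (hL : 5 ≤ L) (i : Fin 2) :
    ∑ k : TorusSite 2 L, Real.cos (latticeMomentum L k i) ^ 4 = 3 * (L : ℝ) ^ 2 / 8 := by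
  have e : ∀ k : TorusSite 2 L, Real.cos (latticeMomentum L k i) ^ 4 =
      3 / 8 + (1 / 2) * Real.cos (2 * latticeMomentum L k i) + (1 / 8) * Real.cos (4 * latticeMomentum L k i) := by
    intro k
    have h2 : Real.cos (2 * latticeMomentum L k i) = 2 * Real.cos (latticeMomentum L k i) ^ 2 - 1 :=
      Real.cos_two_mul _
    have h4 : Real.cos (4 * latticeMomentum L k i) = 2 * Real.cos (2 * latticeMomentum L k i) ^ 2 - 1 := by
      rw [show (4 : ℝ) * latticeMomentum L k i = 2 * (2 * latticeMomentum L k i) by ring]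
      exact Real.cos_two_mul _
    rw [h4, h2]
    ring
  simp_rw [e]
  rw [Finset.sum_add_distrib, Finset.sum_add_distrib, ← Finset.mul_sum, ← Finset.mul_sum]
  have h2 := sum_cos_natMul_latticeMomentum_eq_zero (L := L) (j := 2) (by norm_num) (by omega) i
  have h4 := sum_cos_natMul_latticeMomentum_eq_zero (L := L) (j := 4) (by norm_num) (by omega) i
  simp only [Nat.cast_ofNat] at h2 h4
  have hcard : Fintype.card (TorusSite 2 L) = L ^ 2 := by simp [Fintype.card_pi, ZMod.card]
  rw [h2, h4, Finset.sum_const, Finset.card_univ, hcard]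
  simp only [nsmul_eq_mul]
  push_cast
  ring

/-- `Σ_{v ∈ ℤ/Lℤ} cos²(2πv/L) = L/2` (`L ≥ 3`; one-coordinate form of `sum_cos_sq_latticeMomentum`). [folklore] -/
theorem sum_cos_sq_val (hL : 3 ≤ L) :
    ∑ v : ZMod L, Real.cos (2 * Real.pi * ((v.val : ℝ)) / L) ^ 2 = (L : ℝ) / 2 := by
  have h := sum_cos_sq_latticeMomentum (L := L) hL 0
  have h2 : ∑ k : TorusSite 2 L, Real.cos (latticeMomentum L k 0) ^ 2 =
      ∑ a : ZMod L, ∑ _b : ZMod L, Real.cos (2 * Real.pi * ((a.val : ℝ)) / L) ^ 2 := by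
    simp_rw [latticeMomentum_apply]
    exact sum_torusSite_two (fun a _ => Real.cos (2 * Real.pi * ((a.val : ℝ)) / L) ^ 2)
  rw [h2] at h
  simp only [Finset.sum_const, Finset.card_univ, ZMod.card, nsmul_eq_mul] at h
  rw [← Finset.mul_sum] at h
  have hL0 : (L : ℝ) ≠ 0 := by exact_mod_cast (show L ≠ 0 by omega)
  have hLpos : (0 : ℝ) < L := by exact_mod_cast (show 0 < L by omega)
  field_simp at h
  field_simp
  nlinarith [h]

/-- `Σ_{v ∈ ℤ/Lℤ} cos³(2πv/L) = 0` (`L ≥ 4`; one-coordinate form of `sum_cos_pow_three_latticeMomentum`). [folklore] -/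
theorem sum_cos_pow_three_val (hL : 4 ≤ L) :
    ∑ v : ZMod L, Real.cos (2 * Real.pi * ((v.val : ℝ)) / L) ^ 3 = 0 := by
  have h := sum_cos_pow_three_latticeMomentum (L := L) hL 0
  have h2 : ∑ k : TorusSite 2 L, Real.cos (latticeMomentum L k 0) ^ 3 =
      ∑ a : ZMod L, ∑ _b : ZMod L, Real.cos (2 * Real.pi * ((a.val : ℝ)) / L) ^ 3 := by
    simp_rw [latticeMomentum_apply]
    exact sum_torusSite_two (fun a _ => Real.cos (2 * Real.pi * ((a.val : ℝ)) / L) ^ 3)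
  rw [h2] at h
  simp only [Finset.sum_const, Finset.card_univ, ZMod.card, nsmul_eq_mul] at h
  rw [← Finset.mul_sum] at h
  have hL0 : (L : ℝ) ≠ 0 := by exact_mod_cast (show L ≠ 0 by omega)
  exact (mul_eq_zero.1 h).resolve_left hL0

/-- Mixed sums factor: `Σ_k f(p₀(k)) g(p₁(k)) = (Σ_a f)(Σ_b g)` over the `L × L` grid. [folklore] -/
theorem sum_mul_latticeMomentum_factor (f g : ℝ → ℝ) :
    ∑ k : TorusSite 2 L, f (latticeMomentum L k 0) * g (latticeMomentum L k 1) =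
      (∑ a : ZMod L, f (2 * Real.pi * ((a.val : ℝ)) / L)) *
        ∑ b : ZMod L, g (2 * Real.pi * ((b.val : ℝ)) / L) := by
  have h2 : ∑ k : TorusSite 2 L, f (latticeMomentum L k 0) * g (latticeMomentum L k 1) =
      ∑ a : ZMod L, ∑ b : ZMod L, f (2 * Real.pi * ((a.val : ℝ)) / L) *
        g (2 * Real.pi * ((b.val : ℝ)) / L) := by
    simp_rw [latticeMomentum_apply]
    exact sum_torusSite_two (fun a b => f (2 * Real.pi * ((a.val : ℝ)) / L) *
      g (2 * Real.pi * ((b.val : ℝ)) / L))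
  rw [h2, Finset.sum_mul]
  refine Finset.sum_congr rfl fun a _ => ?_
  rw [Finset.mul_sum]

/-! ### Third and fourth moments of the band -/

/-- **`Σ_k ε_L(k)³ = 0`** on the `L × L` torus, `L ≥ 4` (`ε = -2(c₀ + c₁)`, odd powers of each cosine sum to
zero, mixed terms factor through a vanishing cosine sum). [folklore] -/
theorem sum_torusBand_pow_three (hL : 4 ≤ L) : ∑ k : TorusSite 2 L, torusBand L k ^ 3 = 0 := by
  have e : ∀ k : TorusSite 2 L, torusBand L k ^ 3 =
      -8 * Real.cos (latticeMomentum L k 0) ^ 3 + -8 * Real.cos (latticeMomentum L k 1) ^ 3 +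
        -24 * (Real.cos (latticeMomentum L k 0) ^ 2 * Real.cos (latticeMomentum L k 1)) +
        -24 * (Real.cos (latticeMomentum L k 0) * Real.cos (latticeMomentum L k 1) ^ 2) := by
    intro k
    unfold torusBand
    rw [Fin.sum_univ_two]
    ring
  simp_rw [e]
  rw [Finset.sum_add_distrib, Finset.sum_add_distrib, Finset.sum_add_distrib, ← Finset.mul_sum,
    ← Finset.mul_sum, ← Finset.mul_sum, ← Finset.mul_sum,
    sum_cos_pow_three_latticeMomentum hL 0, sum_cos_pow_three_latticeMomentum hL 1,
    sum_mul_latticeMomentum_factor (fun x => Real.cos x ^ 2) (fun x => Real.cos x),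
    sum_mul_latticeMomentum_factor (fun x => Real.cos x) (fun x => Real.cos x ^ 2),
    sum_cos_val_eq_zero (by omega)]
  ring

/-- **`Σ_k ε_L(k)⁴ = 36 L²`** on the `L × L` torus, `L ≥ 5`: `ε⁴ = 16(c₀⁴ + 4c₀³c₁ + 6c₀²c₁² + 4c₀c₁³ + c₁⁴)`,
`Σ cᵢ⁴ = 3L²/8`, `Σ c₀²c₁² = (L/2)²`, `Σ c₀³c₁ = Σ c₀c₁³ = 0`; `16(3/8 + 3/8 + 6/4) = 36 = C(4,2)²`.
(Equivalently `tr T⁴ = 36 L²`: closed 4-step walks on `ℤ²`.) [folklore] -/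
theorem sum_torusBand_pow_four (hL : 5 ≤ L) :
    ∑ k : TorusSite 2 L, torusBand L k ^ 4 = 36 * (L : ℝ) ^ 2 := by
  have e : ∀ k : TorusSite 2 L, torusBand L k ^ 4 =
      16 * Real.cos (latticeMomentum L k 0) ^ 4 + 16 * Real.cos (latticeMomentum L k 1) ^ 4 +
        64 * (Real.cos (latticeMomentum L k 0) ^ 3 * Real.cos (latticeMomentum L k 1)) +
        64 * (Real.cos (latticeMomentum L k 0) * Real.cos (latticeMomentum L k 1) ^ 3) +
        96 * (Real.cos (latticeMomentum L k 0) ^ 2 * Real.cos (latticeMomentum L k 1) ^ 2) := by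
    intro k
    unfold torusBand
    rw [Fin.sum_univ_two]
    ring
  simp_rw [e]
  rw [Finset.sum_add_distrib, Finset.sum_add_distrib, Finset.sum_add_distrib, Finset.sum_add_distrib,
    ← Finset.mul_sum, ← Finset.mul_sum, ← Finset.mul_sum, ← Finset.mul_sum, ← Finset.mul_sum,
    sum_cos_pow_four_latticeMomentum hL 0, sum_cos_pow_four_latticeMomentum hL 1,
    sum_mul_latticeMomentum_factor (fun x => Real.cos x ^ 3) (fun x => Real.cos x),
    sum_mul_latticeMomentum_factor (fun x => Real.cos x) (fun x => Real.cos x ^ 3),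
    sum_mul_latticeMomentum_factor (fun x => Real.cos x ^ 2) (fun x => Real.cos x ^ 2),
    sum_cos_pow_three_val (by omega), sum_cos_sq_val (by omega)]
  ring

/-! ### Hinge sums through quartic majorants -/

/-- **Quartic majorants of the hinge.** If `max(μ - e, 0) ≤ p₀ + p₁e + p₂e² + p₃e³ + p₄e⁴` on `[-4, 4]`, then
`Σ_k (μ - ε_L(k))₊ ≤ L²(p₀ + 4p₂ + 36p₄)` (`L ≥ 5`; band moments `0, 4L², 0, 36L²`). [folklore] -/
theorem sum_posPart_le_of_quartic (hL : 5 ≤ L) {μ p₀ p₁ p₂ p₃ p₄ : ℝ}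
    (hP : ∀ e : ℝ, -4 ≤ e → e ≤ 4 → max (μ - e) 0 ≤ p₀ + p₁ * e + p₂ * e ^ 2 + p₃ * e ^ 3 + p₄ * e ^ 4) :
    ∑ k : TorusSite 2 L, max (μ - torusBand L k) 0 ≤ (L : ℝ) ^ 2 * (p₀ + 4 * p₂ + 36 * p₄) := by
  have hcard : (Finset.univ : Finset (TorusSite 2 L)).card = L ^ 2 := by
    simp [Finset.card_univ, Fintype.card_pi, ZMod.card]
  calc ∑ k : TorusSite 2 L, max (μ - torusBand L k) 0
      ≤ ∑ k : TorusSite 2 L, (p₀ + p₁ * torusBand L k + p₂ * torusBand L k ^ 2 + p₃ * torusBand L k ^ 3 +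
          p₄ * torusBand L k ^ 4) :=
        Finset.sum_le_sum fun k _ => hP _ (neg_four_le_torusBand L k) (torusBand_le_four L k)
    _ = (L : ℝ) ^ 2 * p₀ + p₁ * (∑ k : TorusSite 2 L, torusBand L k) +
          p₂ * (∑ k : TorusSite 2 L, torusBand L k ^ 2) + p₃ * (∑ k : TorusSite 2 L, torusBand L k ^ 3) +
          p₄ * (∑ k : TorusSite 2 L, torusBand L k ^ 4) := by
        rw [Finset.sum_add_distrib, Finset.sum_add_distrib, Finset.sum_add_distrib, Finset.sum_add_distrib,
          ← Finset.mul_sum, ← Finset.mul_sum, ← Finset.mul_sum, ← Finset.mul_sum, Finset.sum_const, hcard,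
          nsmul_eq_mul]
        push_cast
        ring
    _ = (L : ℝ) ^ 2 * (p₀ + 4 * p₂ + 36 * p₄) := by
        rw [sum_torusBand_eq_zero (by omega), sum_torusBand_sq (by omega), sum_torusBand_pow_three (by omega),
          sum_torusBand_pow_four hL]
        ring

/-! ### The Stoner ceiling with an abstract hinge bound -/

/-- **`Re⟨φ, H₀φ⟩ ≥ (μ a - H - 4b)‖φ‖²` on Lieb's sector `(a, b)`** whenever `Σ_k (μ - ε_L(k))₊ ≤ H` (`L ≥ 3`):
the `↑` part `Σ_k ε_k x_k ≥ μ Σ_k x_k - Σ_k (μ - ε_k)₊ ‖φ‖²` (`0 ≤ x_k ≤ ‖φ‖²`), the `↓` part `≥ -4b‖φ‖²`.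
Lieb–Loss (2001) Thm 1.14 (Lagrangian form of the bathtub principle). [folklore] -/
theorem re_expect_hubbardTorus_zero_ge_hinge (hL : 3 ≤ L) {a b : ℕ}
    {φ : Fock (Orb (FermionTorus 2 L))} (hφ : IsInSector a b φ) {μ H : ℝ}
    (hH : ∑ k : TorusSite 2 L, max (μ - torusBand L k) 0 ≤ H) :
    (μ * a - H - 4 * b) * (star φ ⬝ᵥ φ).re ≤ (star φ ⬝ᵥ (hubbardTorus 2 L 1 0 *ᵥ φ)).re := by
  rw [hubbardTorus_zero_eq_sum_momentumNumber hL, Matrix.sum_mulVec, dotProduct_sum, Complex.re_sum]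
  have hsplit : ∀ k : TorusSite 2 L,
      (star φ ⬝ᵥ ((∑ σ : Fin 2, ((torusBand L k : ℝ) : ℂ) • momentumNumber k σ) *ᵥ φ)).re =
        torusBand L k * (star φ ⬝ᵥ (momentumNumber k 0 *ᵥ φ)).re +
          torusBand L k * (star φ ⬝ᵥ (momentumNumber k 1 *ᵥ φ)).re := by
    intro k
    rw [Matrix.sum_mulVec, dotProduct_sum, Complex.re_sum, Fin.sum_univ_two]
    simp only [Fin.isValue, Matrix.smul_mulVec, dotProduct_smul, smul_eq_mul, Complex.re_ofReal_mul]
  simp only [hsplit, Finset.sum_add_distrib]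
  have hup := sum_re_expect_momentumNumber_up hφ
  have hdown := sum_re_expect_momentumNumber_down hφ
  have hnorm : 0 ≤ (star φ ⬝ᵥ φ).re := (Complex.nonneg_iff.1 (dotProduct_star_self_nonneg φ)).1
  -- `↑`: `ε x ≥ μ x - max(μ - ε, 0) ‖φ‖²` termwise
  have h1 : μ * (a * (star φ ⬝ᵥ φ).re) -
      (∑ k : TorusSite 2 L, max (μ - torusBand L k) 0) * (star φ ⬝ᵥ φ).re ≤
      ∑ k : TorusSite 2 L, torusBand L k * (star φ ⬝ᵥ (momentumNumber k 0 *ᵥ φ)).re := by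
    rw [← hup, Finset.mul_sum, Finset.sum_mul, ← Finset.sum_sub_distrib]
    refine Finset.sum_le_sum fun k _ => ?_
    have hx := re_expect_momentumNumber_mem_Icc k 0 φ
    by_cases hε : μ ≤ torusBand L k
    · rw [max_eq_right (by linarith)]
      nlinarith [hx.1]
    · push Not at hε
      rw [max_eq_left (by linarith)]
      nlinarith [hx.2]
  -- `↓`: `Σ ε x ≥ -4 b ‖φ‖²`
  have h2 : -(4 : ℝ) * (b * (star φ ⬝ᵥ φ).re) ≤
      ∑ k : TorusSite 2 L, torusBand L k * (star φ ⬝ᵥ (momentumNumber k 1 *ᵥ φ)).re := by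
    rw [← hdown, Finset.mul_sum]
    refine Finset.sum_le_sum fun k _ => ?_
    have hx := re_expect_momentumNumber_mem_Icc k 1 φ
    have hε := neg_four_le_torusBand L k
    nlinarith [hx.1, hx.2]
  nlinarith [mul_le_mul_of_nonneg_right hH hnorm]

/-- **HINGE SPIN CEILING** (`U ≥ 0`, `L ≥ 3`, `Σ_k (μ - ε_L(k))₊ ≤ H`, ground state of the `(2n, S^z = 0)` sector
with `S² = S(S+1)`, `S ≤ n`): `μ(n + S) - H - 4(n - S) ≤ E₀` (ladder transfer `minEnergyOn_ge_of_polarisedBound`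
of `re_expect_hubbardTorus_zero_ge_hinge` on `(n + S, n - S)`). [folklore] -/
theorem hinge_spin_le_of_groundState (hL : 3 ≤ L) {U : ℝ} (hU : 0 ≤ U) {n S : ℕ} (hS : S ≤ n)
    {ψ : Fock (Orb (FermionTorus 2 L))} (hgs : IsGroundStateInSector (hubbardTorus 2 L 1 U) (2 * n) 0 ψ)
    (hspin : spinSq *ᵥ ψ = (((S : ℝ) * ((S : ℝ) + 1) : ℝ) : ℂ) • ψ) {μ H : ℝ}
    (hH : ∑ k : TorusSite 2 L, max (μ - torusBand L k) 0 ≤ H) :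
    μ * ((n : ℝ) + S) - H - 4 * ((n : ℝ) - S) ≤
      (hubbardTorus 2 L 1 U).minEnergyOn (szSector (Λ := FermionTorus 2 L) (2 * n) 0) := by
  have h := minEnergyOn_ge_of_polarisedBound (L := L) hU hS
    (c₀ := μ * ((n + S : ℕ) : ℝ) - H - 4 * ((n - S : ℕ) : ℝ))
    (fun φ hφ => re_expect_hubbardTorus_zero_ge_hinge hL hφ hH) hgs hspin
  rw [Nat.cast_sub hS, Nat.cast_add] at h
  exact h

/-- **THE STONER CRITERION WITH AN ABSTRACT HINGE BOUND AND THE EXACT DOUBLON DENSITY.** For `U ≥ 0`, `L ≥ 3`,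
`Σ_k (μ - ε_L(k))₊ ≤ H`, a ground state `ψ` of the `(2n, S^z = 0)` sector of `hubbardTorus 2 L 1 U` with
`S² ψ = S(S+1) ψ`, `S ≤ n`, and any duplicate-free list `l` of `n` momenta (paired Fermi sea `Φ_l`: energy exactly
`2Σ_l ε + U n²/L²`): `2μ n - H - 2Σ_{k∈l} ε_L(k) - U n²/L² ≤ (μ + 4)(n - S)`. Stoner (1938); Tasaki (1998) §5.
[folklore] -/
theorem hinge_spin_le_of_pairedSea_exact (hL : 3 ≤ L) {U : ℝ} (hU : 0 ≤ U) {n S : ℕ} (hS : S ≤ n)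
    {ψ : Fock (Orb (FermionTorus 2 L))} (hgs : IsGroundStateInSector (hubbardTorus 2 L 1 U) (2 * n) 0 ψ)
    (hspin : spinSq *ᵥ ψ = (((S : ℝ) * ((S : ℝ) + 1) : ℝ) : ℂ) • ψ)
    {l : List (TorusSite 2 L)} (hl : l.Nodup) (hlen : l.length = n) {μ H : ℝ}
    (hH : ∑ k : TorusSite 2 L, max (μ - torusBand L k) 0 ≤ H) :
    2 * μ * n - H - 2 * ∑ k ∈ l.toFinset, torusBand L k - U * ((n : ℝ) ^ 2 / (L : ℝ) ^ 2) ≤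
      (μ + 4) * ((n : ℝ) - S) := by
  have h := hinge_spin_le_of_groundState hL hU hS hgs hspin hH
  set Φ : Fock (Orb (FermionTorus 2 L)) :=
    (List.prod (List.map (fun q : TorusSite 2 L => (pairMode q)ᴴ) l)) *ᵥ
      (vacuum : Fock (Orb (FermionTorus 2 L))) with hΦ_def
  have hΦmem : Φ ∈ szSector (Λ := FermionTorus 2 L) (2 * n) 0 := by
    have h := pairedState_mem_szSector (L := L) l
    rwa [hlen] at h
  have hΦ1 : star Φ ⬝ᵥ Φ = 1 := star_pairedState_dotProduct_self hl
  have hHerm : (hubbardTorus 2 L 1 U).IsHermitian := LiebThm1.hamiltonian_isHermitian _ 1 U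
  have hvar := minEnergyOn_le_rayleigh_of_mem hHerm _ hΦmem hΦ1
  rw [hΦ_def, re_expect_hubbardTorus_pairedState hL U hl hlen] at hvar
  linarith

/-- **Quartic-majorant form** (the shape used by the box evaluation): with a quartic `P ≥ (μ - ·)₊` on `[-4,4]`,
`2μ n - L²(p₀ + 4p₂ + 36p₄) - 2Σ_{k∈l} ε_L(k) - U n²/L² ≤ (μ + 4)(n - S)` (`L ≥ 5`). [folklore] -/
theorem quartic_spin_le_of_pairedSea_exact (hL : 5 ≤ L) {U : ℝ} (hU : 0 ≤ U) {n S : ℕ} (hS : S ≤ n)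
    {ψ : Fock (Orb (FermionTorus 2 L))} (hgs : IsGroundStateInSector (hubbardTorus 2 L 1 U) (2 * n) 0 ψ)
    (hspin : spinSq *ᵥ ψ = (((S : ℝ) * ((S : ℝ) + 1) : ℝ) : ℂ) • ψ)
    {l : List (TorusSite 2 L)} (hl : l.Nodup) (hlen : l.length = n) {μ p₀ p₁ p₂ p₃ p₄ : ℝ}
    (hP : ∀ e : ℝ, -4 ≤ e → e ≤ 4 → max (μ - e) 0 ≤ p₀ + p₁ * e + p₂ * e ^ 2 + p₃ * e ^ 3 + p₄ * e ^ 4) :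
    2 * μ * n - (L : ℝ) ^ 2 * (p₀ + 4 * p₂ + 36 * p₄) - 2 * ∑ k ∈ l.toFinset, torusBand L k -
        U * ((n : ℝ) ^ 2 / (L : ℝ) ^ 2) ≤ (μ + 4) * ((n : ℝ) - S) :=
  hinge_spin_le_of_pairedSea_exact (le_trans (by norm_num) hL) hU hS hgs hspin hl hlen
    (sum_posPart_le_of_quartic hL hP)

end Quartic

/-- Registered sub-goal form (item stmt-HubbardSuperconductivity-7331, line `redirect_birth`, lead c11): the
fourth band moment `Σ_k ε_L(k)⁴ = 36 L²` for `L ≥ 5`. [folklore] -/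
theorem sumTorusBandPowFour : ∀ {L : ℕ} [NeZero L], 5 ≤ L →
    ∑ k : TorusSite 2 L, torusBand L k ^ 4 = 36 * (L : ℝ) ^ 2 :=
  fun hL => sum_torusBand_pow_four hL

end Summit.HubbardSuperconductivity.HubbardSuperconductivity.Theorems.MesoscopicPairOrder.Negative
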